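import Summits.QuantumAdvantage.AdviceFreeQNC0.GradedSeeds38JuntaReduction
import HarnessLib

/-!
# Cell qa-qnc0, `p = 3` — GRADED seeds, part 4: the reduction under the RE-TYPED twisted junta bound (R1) of planner qa-qnc0-p2 g36
(prover qn-prover-3 g22; ROUND-36P2 §4 / P2-36a(iii))

Planner qa-qnc0-p2 g36 refuted numerically (ROUND-36P2 §2: "speakers", a factor `4/9` per junta GROUP of twisted letters) the analytic
input `GradedSeeds38.TwistedJuntaBoundX3 ρ` for every `ρ < 1`, so `gradedJuntaReduction` (part 3) has an unsatisfiable premise.  The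
re-typed input that survives all K-36 data is (R1) `TwistedJunta36.TwistedJuntaBoundX3S ρ` (typed VERBATIM below from
`HOME/qa-qnc0-p2/exp36p2/TwistedJunta36.lean`): exponent `⌊#(supp β ∖ W) / (log₂N)^C⌋` — one junta's worth of twisted letters buys ONE
factor `ρ`.  As the planner observed (P2-36a(iii)), the proof of `gradedJuntaReduction` goes through VERBATIM with the seed schedule
inflated by `(log₂N)^C`: this file proves

  `gradedJuntaReductionS : ∀ ρ α, 0 ≤ ρ → 3ρ^α < 1 → TwistedJuntaBoundX3S ρ → SeedJuntaHardXS α`,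

`SeedJuntaHardXS` = `SeedJuntaHardX` with schedule `(log₂N)^C·(α(j+1) + D·log₂N)` (the residual core of ROUND-37 §4 widens by `(log₂N)^C`).

WHAT THIS IS NOT: (R1) is OPEN (a conjecture with no technique for scattered juntas, ROUND-36P2 §4.2); crux 22907 untouched; no ledger
item (D-0168 shelf).

STATUS OF (R1) (qn-prover-3 g25/g26, kernel-line fibre method; all for `ρ = 39/40` unless stated): PROVED at `C = 0`
(`R1OneFibre39`: `SparseRead39.r1One`, `twistedJuntaBoundX3S_zero`) and, for every `C`, VERBATIM under one extra hypothesis on the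
outside reads `T k ∖ W` — pairwise disjoint (`R1DisjointReads39`), read multiplicity `≤ m` (`R1PairMass39`, `ρ_m = (39/40)^{1/m}`),
size `≤ w₀` with arbitrary overlaps (`R1JuntaSize39`, `ρ_{w₀}`), pairwise equal-or-disjoint / cell-confined (`R1CellReads39`), co-read
degree `< (log₂N)^C` (`R1CoDegree39`); in general up to the `d`-cap number of the read family (`R1CellReads39.norm_twistedWinSum_le_of_capSet`).
OPEN only for read families of `(log₂N)^C`-sets, `C ≥ 1`, whose cap numbers are all small (pair-covering / design-like overlaps of unbounded
multiplicity), where the liveness of the bells must be used.  The structured branch `SeedJuntaHardXS`-shape is unconditional for each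
proved class (`SeedJuntaRestricted39`, `R1JuntaSize39`, `R1CellReads39`, `R1CoDegree39`).
-/

noncomputable section

namespace Summit.QuantumAdvantage.AdviceFreeQNC0

open Finset Literature.Computability.QuantumComplexity Literature.Computability.MetaComplexity

namespace TwistedJunta36

/-- **(R1) size-normalised twisted junta bound** (planner qa-qnc0-p2 g36, ROUND-36P2 §4; VERBATIM from `exp36p2/TwistedJunta36.lean`).
Exponent `#(supp β \ W) / (log₂N)^C` (one junta's worth of twisted letters buys ONE factor `ρ`): consistent with the block resonance
(`0.445` per block), with the radius-`≤ 3` optimum `0.915/letter` (K-36A) and with scattered juntas (K-36B).  OPEN in general;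
PROVED at `C = 0` and for every `C` under structural hypotheses on the outside reads (see the STATUS paragraph of the module docstring:
`R1OneFibre39`, `R1DisjointReads39`, `R1PairMass39`, `R1JuntaSize39`, `R1CellReads39`, `R1CoDegree39`). -/
def TwistedJuntaBoundX3S (ρ : ℝ) : Prop :=
  open scoped Classical in
  ∀ C : ℕ, ∃ A n₀ : ℕ, ∀ N ≥ n₀,
    ∀ (W : Finset (Fin N)) (T : Fin N → Finset (Fin N)) (g : Fin N → (Fin N → Bool) → Bool),
      3 * W.card ≤ N → (∀ k, (T k \ W).card ≤ (Nat.log 2 N) ^ C) →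
      (∀ k (x x' : Fin N → Bool), (∀ i ∈ T k, x i = x' i) → g k x = g k x') →
        ∀ β : Fin N → ZMod 3,
          ‖∑ x : Fin N → Bool, (ZMod.stdAddChar (∑ i : Fin N, if x i then β i else 0) : ℂ) *
              (if (OddZeros x ∧ RingHLF.Rel x (fun k => g k x)) then (1 : ℂ) else 0)‖
            ≤ (N : ℝ) ^ A * ρ ^ ((univ.filter fun i : Fin N => i ∉ W ∧ β i ≠ 0).card / (Nat.log 2 N) ^ C) * (2 : ℝ) ^ N

/-- Sanity (planner p2 g36, verbatim): the original bound implies the size-normalised one for `0 ≤ ρ ≤ 1`. -/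
theorem twistedJuntaBoundX3S_of_X3 {ρ : ℝ} (h0 : 0 ≤ ρ) (h1 : ρ ≤ 1) (h : GradedSeeds38.TwistedJuntaBoundX3 ρ) :
    TwistedJuntaBoundX3S ρ := by
  intro C
  obtain ⟨A, n₀, hA⟩ := h C
  refine ⟨A, n₀, fun N hN W T g hW hT hg β => ?_⟩
  refine le_trans (hA N hN W T g hW hT hg β) ?_
  apply mul_le_mul_of_nonneg_right _ (by positivity)
  apply mul_le_mul_of_nonneg_left _ (by positivity)
  exact pow_le_pow_of_le_one h0 h1 (Nat.div_le_self _ _)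

end TwistedJunta36

namespace GradedSeeds38

open TwistedJunta36

/-- **The structured branch with the INFLATED schedule**: as `SeedJuntaHardX α` but the seeds are graded-spread outside `W` with
schedule `(log₂N)^C · (α(j+1) + D·log₂N)`. -/
def SeedJuntaHardXS (α : ℕ) : Prop :=
  open scoped Classical in
  ∃ θ : ℝ, θ < 1 ∧ ∀ C : ℕ, ∃ D n₀ : ℕ, ∀ N ≥ n₀,
    ∀ (W : Finset (Fin N)) (R : ℕ) (c : Fin R → Fin N → ZMod 3) (T : Fin N → Finset (Fin N))
      (H : Fin N → (Fin R → ZMod 3) → (Fin N → Bool) → Bool),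
      3 * W.card ≤ N → GradedSpreadOff W c (fun j => (Nat.log 2 N) ^ C * (α * (j.val + 1) + D * Nat.log 2 N)) →
      (∀ k, (T k \ W).card ≤ (Nat.log 2 N) ^ C) →
      (∀ k v (x x' : Fin N → Bool), (∀ i ∈ T k, x i = x' i) → H k v x = H k v x') →
        ((univ.filter fun x : Fin N → Bool =>
            OddZeros x ∧ RingHLF.Rel x (fun k => H k (LinForms.resVec c x) x)).card : ℝ)
          ≤ θ * (2 : ℝ) ^ (N - 1)

/-- **TARGET `GradedJuntaReductionS`**: the re-typed twisted junta bound (R1) transfers junta hardness to all seed ⊕ junta strategies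
with the inflated schedule. -/
def GradedJuntaReductionS : Prop :=
  ∀ (ρ : ℝ) (α : ℕ), 0 ≤ ρ → 3 * ρ ^ α < 1 → TwistedJuntaBoundX3S ρ → SeedJuntaHardXS α

section ReductionS

open scoped Classical in
/-- **`gradedJuntaReductionS : GradedJuntaReductionS` — PROVED** (the proof of `gradedJuntaReduction` verbatim; the only change: the
spread `(log₂N)^C·(α(j+1) + α(A+1)log₂N) ≤ #(supp ∖ W)` gives `α(j+1) + α(A+1)log₂N ≤ #(supp ∖ W)/(log₂N)^C` for `N ≥ 2`). -/
theorem gradedJuntaReductionS : GradedJuntaReductionS := by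
  classical
  intro ρ α hρ hq hTJ
  obtain ⟨θ, hθ, hcover⟩ := AffBells34.coverPolylogHard
  refine ⟨(1 + θ) / 2, by linarith, fun C => ?_⟩
  obtain ⟨n₁, hn₁⟩ := hcover C
  obtain ⟨A, n₂, hn₂⟩ := hTJ C
  -- the ratio `q = 3ρ^α ∈ [0,1)` and `ρ^α ≤ 1/2`, `ρ ≤ 1`
  have hρα0 : 0 ≤ ρ ^ α := pow_nonneg hρ α
  have hq0 : 0 ≤ 3 * ρ ^ α := by positivity
  have hρα : ρ ^ α ≤ 1 / 2 := by linarith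
  have hρ1 : ρ ≤ 1 := by
    by_contra h
    have h1 : 1 ≤ ρ ^ α := one_le_pow₀ (le_of_lt (not_le.1 h))
    linarith
  have h1θ : 0 < (1 - θ) / 2 := by linarith
  -- the error constant
  obtain ⟨n₃, hn₃⟩ : ∃ n₃ : ℕ, (2 : ℝ) ^ (A + 2) * (3 * ρ ^ α / (1 - 3 * ρ ^ α)) / ((1 - θ) / 2) ≤ n₃ :=
    ⟨_, Nat.le_ceil _⟩
  refine ⟨α * (A + 1), max (max n₁ n₂) (max n₃ 2), fun N hN W R c T H hW hspread hT hH => ?_⟩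
  have hN1 : n₁ ≤ N := le_trans (le_trans (le_max_left _ _) (le_max_left _ _)) hN
  have hN2 : n₂ ≤ N := le_trans (le_trans (le_max_right _ _) (le_max_left _ _)) hN
  have hN3 : n₃ ≤ N := le_trans (le_trans (le_max_left _ _) (le_max_right _ _)) hN
  have hNtwo : 2 ≤ N := le_trans (le_trans (le_max_right _ _) (le_max_right _ _)) hN
  have hNone : 1 ≤ N := by omega
  have hNpos : (0 : ℝ) < N := by exact_mod_cast hNone
  set L : ℕ := Nat.log 2 N with hL
  set P : (Fin R → ZMod 3) → (Fin N → Bool) → Prop := fun v x =>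
    OddZeros x ∧ RingHLF.Rel x (fun k => H k v x) with hP
  set Bj : Fin R → ℝ := fun j => (N : ℝ) ^ A * ρ ^ (α * (j.val + 1) + α * (A + 1) * L) * (2 : ℝ) ^ N with hBj
  have hBj0 : ∀ j, 0 ≤ Bj j := fun j => by positivity
  -- (a) main term: frozen seed residues give a `W`-tolerant polylog-junta strategy (`coverPolylogHard`)
  have ha : ∀ v : Fin R → ZMod 3,
      ∑ x : Fin N → Bool, (if P v x then (1 : ℝ) else 0) ≤ θ * (2 : ℝ) ^ (N - 1) := by
    intro v
    have h := hn₁ N hN1 W T (fun k x => H k v x) hW hT (fun k => fun x x' hxx' => hH k v x x' hxx')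
    rw [sum_boole]
    simpa [AffBells22.winCount, hP] using h
  -- (b) graded twisted sums: `TwistedJuntaBoundX3S` (exponent `#(supp β ∖ W) / (log₂N)^C`)
  have hb : ∀ (v γ : Fin R → ZMod 3) (j : Fin R), IsTop γ j →
      ‖∑ x : Fin N → Bool, (ZMod.stdAddChar (∑ i, γ i * LinForms.resVec c x i) : ℂ) *
          ((if P v x then (1 : ℝ) else 0 : ℝ) : ℂ)‖ ≤ Bj j := by
    intro v γ j hj
    set β : Fin N → ZMod 3 := fun m => ∑ i, γ i * c i m with hβ
    have hres : ∀ x : Fin N → Bool, ∑ i, γ i * LinForms.resVec c x i = ∑ m, if x m then β m else 0 := by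
      intro x
      simp only [LinForms.resVec, hβ, mul_sum]
      rw [sum_comm]
      refine sum_congr rfl fun m _ => ?_
      split_ifs <;> simp
    have h := hn₂ N hN2 W T (fun k x => H k v x) hW hT (fun k x x' hxx' => hH k v x x' hxx') β
    have hcast : ∀ x : Fin N → Bool, (((if P v x then (1 : ℝ) else 0 : ℝ)) : ℂ) = (if P v x then (1 : ℂ) else 0) := by
      intro x; split_ifs <;> simp
    simp_rw [hres, hcast]
    refine le_trans (by simpa [hP] using h) ?_
    have hLC : 0 < L ^ C := by
      have hL1 : 1 ≤ L := by rw [hL]; exact Nat.le_log_of_pow_le (by norm_num) (by simpa using hNtwo)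
      exact pow_pos (by omega) C
    have hw0 : L ^ C * (α * (j.val + 1) + α * (A + 1) * L) ≤ (univ.filter fun i : Fin N => i ∉ W ∧ β i ≠ 0).card :=
      hspread γ j hj
    have hw : α * (j.val + 1) + α * (A + 1) * L ≤ (univ.filter fun i : Fin N => i ∉ W ∧ β i ≠ 0).card / L ^ C := by
      rw [Nat.le_div_iff_mul_le hLC, mul_comm]; exact hw0
    calc (N : ℝ) ^ A * ρ ^ ((univ.filter fun i : Fin N => i ∉ W ∧ β i ≠ 0).card / L ^ C) * (2 : ℝ) ^ N
        ≤ (N : ℝ) ^ A * ρ ^ (α * (j.val + 1) + α * (A + 1) * L) * (2 : ℝ) ^ N := by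
          gcongr _ * ?_ * _
          exact pow_le_pow_of_le_one hρ hρ1 hw
      _ = Bj j := rfl
  -- the graded expansion
  have hmain := sum_le_max_add_graded (p := 3) (fun x : Fin N → Bool => LinForms.resVec c x)
    (fun v x => if P v x then (1 : ℝ) else 0) (θ * (2 : ℝ) ^ (N - 1)) Bj hBj0 ha hb
  have hset : ((univ.filter fun x : Fin N → Bool =>
      OddZeros x ∧ RingHLF.Rel x (fun k => H k (LinForms.resVec c x) x)).card : ℝ)
      = ∑ x : Fin N → Bool, (if P (LinForms.resVec c x) x then (1 : ℝ) else 0) := by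
    rw [sum_boole]
  rw [hset]
  refine hmain.trans ?_
  -- (c) the error term `Σ_j 3^{j+1} Bj j ≤ ((1-θ)/2)·2^{N-1}`
  have herr : ∑ j : Fin R, ((3 : ℕ) : ℝ) ^ (j.val + 1) * Bj j ≤ ((1 - θ) / 2) * (2 : ℝ) ^ (N - 1) := by
    have hterm : ∀ j : Fin R, ((3 : ℕ) : ℝ) ^ (j.val + 1) * Bj j =
        (3 * ρ ^ α) ^ (j.val + 1) * ((N : ℝ) ^ A * (ρ ^ α) ^ ((A + 1) * L) * (2 : ℝ) ^ N) := by
      intro j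
      have e1 : ρ ^ (α * (j.val + 1) + α * (A + 1) * L) = (ρ ^ α) ^ (j.val + 1) * (ρ ^ α) ^ ((A + 1) * L) := by
        rw [pow_add, pow_mul, mul_assoc, pow_mul]
      have eB : Bj j = (N : ℝ) ^ A * ρ ^ (α * (j.val + 1) + α * (A + 1) * L) * (2 : ℝ) ^ N := rfl
      rw [eB, e1, mul_pow]; push_cast; ring
    rw [sum_congr rfl fun j _ => hterm j, ← sum_mul]
    have hN2 : (2 : ℝ) ^ N = 2 * (2 : ℝ) ^ (N - 1) := by
      rw [← pow_succ']; congr 1; omega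
    have hgeo := sum_pow_succ_le_div (3 * ρ ^ α) hq0 hq R
    have hdec := pow_mul_decay_le N A hNone (ρ ^ α) hρα0 hρα
    have hq1 : 0 < 1 - 3 * ρ ^ α := by linarith
    have hK0 : 0 ≤ 3 * ρ ^ α / (1 - 3 * ρ ^ α) := div_nonneg hq0 hq1.le
    have hp : (0 : ℝ) ≤ (2 : ℝ) ^ (N - 1) := by positivity
    -- `N ≥ n₃` gives `2^{A+2} · (q/(1-q)) / N ≤ (1-θ)/2`
    have hN3' : (2 : ℝ) ^ (A + 2) * (3 * ρ ^ α / (1 - 3 * ρ ^ α)) / ((1 - θ) / 2) ≤ N :=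
      hn₃.trans (by exact_mod_cast hN3)
    have hkey : (2 : ℝ) ^ (A + 2) * (3 * ρ ^ α / (1 - 3 * ρ ^ α)) / N ≤ (1 - θ) / 2 := by
      rw [div_le_iff₀ hNpos]
      rw [div_le_iff₀ h1θ] at hN3'
      linarith
    calc (∑ j : Fin R, (3 * ρ ^ α) ^ (j.val + 1)) * ((N : ℝ) ^ A * (ρ ^ α) ^ ((A + 1) * L) * (2 : ℝ) ^ N)
        ≤ (3 * ρ ^ α / (1 - 3 * ρ ^ α)) * ((2 : ℝ) ^ (A + 1) / N * (2 : ℝ) ^ N) := by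
          refine mul_le_mul hgeo ?_ (by positivity) hK0
          exact mul_le_mul_of_nonneg_right hdec (by positivity)
      _ = ((2 : ℝ) ^ (A + 2) * (3 * ρ ^ α / (1 - 3 * ρ ^ α)) / N) * (2 : ℝ) ^ (N - 1) := by
          rw [hN2]; ring
      _ ≤ ((1 - θ) / 2) * (2 : ℝ) ^ (N - 1) := mul_le_mul_of_nonneg_right hkey hp
  have h3 : ∑ j : Fin R, ((3 : ℕ) : ℝ) ^ (j.val + 1) * Bj j = ∑ j : Fin R, (3 : ℝ) ^ (j.val + 1) * Bj j := by
    push_cast; rfl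
  linarith [herr]


end ReductionS

end GradedSeeds38

end Summit.QuantumAdvantage.AdviceFreeQNC0

end
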